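import Literature.Probability.RandomPlanarGeometry.SLETraceApproximation
import HarnessLib

/-!
# A measurable projection of the raw path space onto continuous paths

We construct a map `P : (ℝ≥0 → ℝ) → C(ℝ≥0, ℝ)`, measurable from the product σ-algebra to the
Borel σ-algebra of the compact-open topology (scoped instances `PathBorel` of
`SLETraceApproximation.lean`), with `P W = W` for every continuous `W`
(`exists_measurable_continuousMap_proj`). This is the bridge between "a process with continuous
paths, seen in `ℝ≥0 → ℝ` with the product σ-algebra" (the canonical Brownian space) and "a random
element of `C(ℝ≥0, ℝ)`" in the direction raw path ↦ continuous path, needed to apply functionals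
defined (and measurable) on `C(ℝ≥0, ℝ)` to the canonical process.

Construction: sample a continuous path along a dense sequence `d : ℕ → ℝ≥0`
(`TopologicalSpace.denseSeq`). The sampling map `e : C(ℝ≥0, ℝ) → (ℕ → ℝ)`, `e W = W ∘ d`, is
continuous and injective (continuous functions agreeing on a dense set are equal), from the
Polish space `C(ℝ≥0, ℝ)` to the Polish space `ℕ → ℝ`, hence a measurable embedding by the
Lusin–Souslin theorem (Mathlib `Continuous.measurableEmbedding`); a measurable embedding admits a
measurable left inverse `P₀` (Mathlib `MeasurableEmbedding.measurable_extend`), and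
`P W := P₀ (W ∘ d)`. Billingsley (1999), §7 (random functions) with Kechris (1995), Thm. 15.1
(Lusin–Souslin: injective Borel maps between Polish spaces have Borel images, hence measurable
inverses).

## References

* A. S. Kechris, *Classical Descriptive Set Theory*, Springer (1995), Thm. 15.1 (Lusin–Souslin).
* P. Billingsley, *Convergence of Probability Measures*, 2nd ed., Wiley (1999), §7.
-/

noncomputable section

open Set Filter Topology MeasureTheory TopologicalSpace
open scoped NNReal

namespace Literature.Probability.RandomPlanarGeometry

open scoped PathBorel

/-- **Sampling along a dense sequence is a measurable embedding** of `C(ℝ≥0, ℝ)` (Borel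
σ-algebra of the compact-open topology) into `ℕ → ℝ`: the map `W ↦ (W (dₙ))ₙ`, `d = denseSeq ℝ≥0`,
is continuous (evaluations) and injective (continuous functions agreeing on a dense set are
equal) on a Polish space, hence a measurable embedding by the Lusin–Souslin theorem (Mathlib
`Continuous.measurableEmbedding`). Kechris (1995), Thm. 15.1. [folklore] -/
theorem measurableEmbedding_samplePath :
    MeasurableEmbedding fun (W : C(ℝ≥0, ℝ)) (n : ℕ) ↦ W (denseSeq ℝ≥0 n) := by
  have hc : Continuous fun (W : C(ℝ≥0, ℝ)) (n : ℕ) ↦ W (denseSeq ℝ≥0 n) :=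
    continuous_pi fun n ↦ continuous_eval_const (denseSeq ℝ≥0 n)
  have hi : Function.Injective fun (W : C(ℝ≥0, ℝ)) (n : ℕ) ↦ W (denseSeq ℝ≥0 n) := by
    intro W₁ W₂ h
    refine ContinuousMap.ext fun t ↦ ?_
    have hEq : EqOn W₁ W₂ (range (denseSeq ℝ≥0)) := by
      rintro _ ⟨n, rfl⟩
      exact congr_fun h n
    exact congr_fun
      (Continuous.ext_on (denseRange_denseSeq ℝ≥0) W₁.continuous W₂.continuous hEq) t
  exact hc.measurableEmbedding hi

/-- **A measurable projection of the raw path space onto continuous paths**: there is a map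
`P : (ℝ≥0 → ℝ) → C(ℝ≥0, ℝ)`, measurable from the product σ-algebra to the Borel σ-algebra of
locally uniform convergence, which is the identity on continuous paths. (A measurable left
inverse of the sampling embedding `measurableEmbedding_samplePath`, Mathlib
`MeasurableEmbedding.measurable_extend`, precomposed with sampling of the raw path along the same
dense sequence.) Billingsley (1999), §7 (a continuous-path process is a random element of path
space) with Kechris (1995), Thm. 15.1 (Lusin–Souslin). [folklore] -/
theorem exists_measurable_continuousMap_proj :
    ∃ P : (ℝ≥0 → ℝ) → C(ℝ≥0, ℝ), Measurable P ∧ ∀ W : C(ℝ≥0, ℝ), P W = W := by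
  have he := measurableEmbedding_samplePath
  set P₀ : (ℕ → ℝ) → C(ℝ≥0, ℝ) :=
    Function.extend (fun (W : C(ℝ≥0, ℝ)) (n : ℕ) ↦ W (denseSeq ℝ≥0 n)) id fun _ ↦ 0 with hP₀
  have hP₀ : Measurable P₀ := he.measurable_extend measurable_id measurable_const
  have hs : Measurable fun (W : ℝ≥0 → ℝ) (n : ℕ) ↦ W (denseSeq ℝ≥0 n) :=
    measurable_pi_lambda _ fun n ↦ measurable_pi_apply _
  refine ⟨fun W ↦ P₀ fun n ↦ W (denseSeq ℝ≥0 n), hP₀.comp hs, fun W ↦ ?_⟩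
  exact he.injective.extend_apply _ _ W

end Literature.Probability.RandomPlanarGeometry
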